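import Literature.AlgebraicGeometry.HodgeTheory.CMCurveTimesSimpleCMSurfaceStablyNondegenerate
import Literature.AlgebraicGeometry.HodgeTheory.SimpleAbelianThreefoldPowersHodgeClasses
import Literature.AlgebraicGeometry.HodgeTheory.FiniteProductsMixedPowersRetract
import Literature.AlgebraicGeometry.HodgeTheory.HodgeConjectureAbelianSubquotients
import Literature.AlgebraicGeometry.ComplexMultiplication.SimpleCMAbelianVarietyIsogenyClasses
import Literature.AlgebraicGeometry.Milne1999.CMTypeSimpleIsogenyFactors
import Literature.AlgebraicGeometry.Pohlmann1968.SeparatingCMFamilies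
import Literature.NumberTheory.ComplexMultiplication.ShimuraTaniyamaHecke
import Literature.NumberTheory.ComplexMultiplication.SharedImaginaryQuadraticDegenerate
import HarnessLib

/-!
# A CM elliptic curve `E_k` times a SIMPLE CM abelian variety `X`: `Hg(E × X) = Hg(E) × Hg(X)` iff `k ↪̸ End⁰(X)` (Moonen–Zarhin 1999, Prop. (3.8)); for `X = T` a simple CM THREEFOLD the dichotomy (a)/(4) of Thm. 0.1: `E × T` is stably nondegenerate IFF `k ↪̸ End⁰(T)` — PROVED

Family `hodge`, layer `Literature/AlgebraicGeometry/HodgeTheory`. Research context: cell `pub-hodge-ring2`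
(HONEST FRAMING: research route conditional on HC_CM; not a corollary; Q11.4-sentence-2 already refuted in
dim ≥ 3), Literature lane (lit seat, generation 53; sequel of `HodgeTheory/CMCurveTimesSimpleCMSurfaceStablyNondegenerate`,
whose §2 rank additivity `typeRank_sum_add_one_eq_of_finrank_eq_two_of_isEmpty` is the engine of §§1–3). Theorems
only: no definition, no named fact, no `sorry`; nothing here uses or asserts HC_CM — the negative half (§§4–6) says
where exceptional (Weil) classes live, not whether they are algebraic.

PUBLISHED STATEMENTS. Moonen–Zarhin, Math. Ann. 315 (1999) [corpus: paper:arxiv-math_9901113 pp. 1–2, 6–8].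
Prop. (3.8) (p. 7): «Let `X` be an abelian variety and let `E` be an elliptic curve, both over `ℂ`. Suppose
`Hom(E,X) = 0`. Then either `Hg(X × E) = Hg(X) × Hg(E)` or `End⁰(E) = k` is an imaginary quadratic field such that
there exists an embedding of `k` into the center of `End⁰(X)`»; §3 (3.1): «[`Hg(X₁ × X₂) ≠ Hg(X₁) × Hg(X₂)`] holds if
and only if for some `m` and `n` the Hodge ring `B•(X₁^m × X₂^n)` is not generated by the elements coming from
`B•(X₁^m)` and `B•(X₂^n)`»; Introduction and Thm. 0.1 (pp. 1–2): «(a) The abelian variety `X` is isogenous to a product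
`X₁ × X₂` where `X₁` is an elliptic curve with complex multiplication by an imaginary quadratic field `k` and where `X₂`
is a simple abelian threefold such that there exists an embedding `k ↪ End⁰(X₂)`. […] (1) Suppose we are in case (a)
or (b). Then the Hodge ring `B•(X)` is generated by the subalgebra `D•(X)` of divisor classes together with the space of
Weil classes `W_k ⊂ B²(X)`. The Hodge group `Hg(X)` is strictly contained in `Sp_D(V,φ)`. […] (4) Suppose we are not
in one of the cases (a), (b), (c) or (d). Then `Hg(X) = Sp_D(V,φ)` and `B•(Xⁿ) = D•(Xⁿ)` for all `n`. […] in the cases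
(a), (b) and (c) the Weil classes are really needed to generate the Hodge ring; in these cases we have `D²(X) ≠ B²(X)`.»

HERE `X` (resp. `X₂ = T`) is SIMPLE OF CM TYPE, so `End⁰(X) = K` is a CM field of degree `2 dim X`, its own centre,
and «`k ↪` centre of `End⁰(X)`» is a ring homomorphism `End⁰(E) → End⁰(X)`.  Both halves are the tree's CM-type rank
calculus: `k ↪̸ K` ⟹ the `Aut(ℂ)`-stabiliser of `Hom(k,ℂ)` is transitive on `Hom(K,ℂ)`, no common constituent, rank
ADDITIVE (previous file, §2) ⟹ product span on all `E^{a+1} × X^{b+1}` (Moonen–Zarhin (3.1) ⟸ for CM products, the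
tree's `Pohlmann1968.hodgeClassesProductSpan_of_isIsogenous_biproduct_slots_of_typeRank_add`); `k ↪ K` with
`[K:ℚ]/2 = dim X` ODD ⟹ the family `(Φ_k, Φ_K)` is DEGENERATE for every choice of CM types (the signature defects
`Σ_{φ∈Φ} ±1` are odd, `SharedImaginaryQuadraticDegenerate.not_isNondegenerateFamily_of_shared_quadratic_of_odd`) ⟹ some
product of copies of `E', X'` carries an EXCEPTIONAL Hodge class (Pohlmann's theorem for the CM algebra `k × K`,
`CMAlgebra.exists_exceptional_prod_of_not_isNondegenerateFamily`, the family being separating: simple, non-isogenous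
members) ⟹ being a retract of `(E' × X')^N`, that product would be divisor-generated if `E × X` were stably
nondegenerate (`IsDivisorGenerated.of_comp_eq_nsmul_id`; Hazama–Murty / Gordon Thm. 7.5).

RESULTS.
* §1 `hodgeClassesProductSpan_powSucc_powSucc_of_isCMTypeRealisation_of_isEmpty` — realisation level: `E ∼ E'`,
  `X ∼ X'` realising CM types of `k` (quadratic) and `K` with `IsEmpty (k →+* K)` ⟹ the product-span property on EVERY
  `E^{a+1} × X^{b+1}`.
* §2 INTRINSIC: **`hodgeClassesProductSpan_powSucc_cmCurve_powSucc_of_isSimple_of_isOfCMType_of_isEmpty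
  (hE : E.dim = 1) (hEcm : IsOfCMType E) (hX : X.IsSimple) (hX0 : 0 < X.dim) (hXcm : IsOfCMType X)
  (hfor : IsEmpty (E.endAlgebra →+* X.endAlgebra)) (a b : ℕ)`** (`Hg(E × X) = Hg(E) × Hg(X)` read through (3.1);
  an embedding `k ↪ K` of CM fields would give `End⁰(E) ≅ End⁰(E') = k ↪ K ↪ End⁰(X') ↪ End⁰(X)` —
  `exists_ringHom_endAlgebra`, `ringHom_endAlgebra_bijective_of_isSimple`, `IsIsogeny.exists_algHom_injective`);
  **`IsStablyNondegenerate.cmCurve_prod_of_isSimple_of_isOfCMType_of_isEmpty`** — if moreover `X` satisfies (D) then so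
  do `E × X`, `X × E` and all `E^{a+1} × X^{b+1}`.
* §3 THE FOURFOLD ROW «(4), not (a)»: **`isStablyNondegenerate_cmCurve_prod_of_isSimple_threefold_of_isOfCMType_of_isEmpty`**
  — `E_k × T`, `T` a SIMPLE CM threefold with `k ↪̸ End⁰(T)`, is stably nondegenerate (`T` is, by the tree's
  `AbelianVariety.isStablyNondegenerate_of_isSimple_of_dim_three`); the Hodge conjecture for all powers `(E × T)^{N+1}`
  and everything isogenous to them, UNCONDITIONALLY.
* §4 `not_isStablyNondegenerate_prod_of_isCMTypeRealisation_of_ringHom_of_odd` — realisation level converse: `[K:ℚ]/2`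
  ODD, `X'` simple and not isogenous to `E'`, an embedding `j : k ↪ K` ⟹ `¬ IsStablyNondegenerate (E × X)`.
* §5 `not_isStablyNondegenerate_cmCurve_prod_of_isSimple_of_isOfCMType_of_odd` (intrinsic: `X` simple CM of ODD
  dimension `≠ 1`, a ring map `End⁰(E) → End⁰(X)`), and the EXACT CRITERION
  `isStablyNondegenerate_cmCurve_prod_iff_isEmpty_of_isSimple_of_isOfCMType_of_odd` for such `X` satisfying (D).
* §6 **`isStablyNondegenerate_cmCurve_prod_iff_isEmpty_of_isSimple_threefold`** — for `E` an elliptic curve of CM type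
  and `T` a SIMPLE abelian threefold of CM type: `IsStablyNondegenerate (E × T) ↔ IsEmpty (End⁰(E) →+* End⁰(T))` —
  Moonen–Zarhin's (a) versus (4) for these CM fourfolds as a kernel biconditional; and case (a) itself,
  `not_isStablyNondegenerate_cmCurve_prod_of_isSimple_threefold_of_isOfCMType_of_ringHom`.

## References
* [MoonenZarhin1999LowDim] B. Moonen, Yu. Zarhin, Math. Ann. 315 (1999) 711–733: Introduction (a), Thm. 0.1 (1)/(4)
  with the remark «`D²(X) ≠ B²(X)`», §3 (3.1), Thm. (3.2), Prop. (3.8), Cor. (3.9), (5.3)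
  [corpus: paper:arxiv-math_9901113 pp. 1–2, 6–8]. [cite: MoonenZarhin1999LowDim, Prop. (3.8) and Thm. 0.1 (1)/(4)]
* [Gordon1999HodgeAVSurvey] B. B. Gordon, *A survey of the Hodge conjecture for abelian varieties*, §3 Theorem
  (Imai, Murty) with proof; Thm. 7.5, Def. 7.6, 7.6.1. [cite: Gordon1999HodgeAVSurvey, Thm. 7.5 and 7.6.1]
* [Deligne1982HodgeCycles] P. Deligne, *Hodge cycles on abelian varieties*, LNM 900 (1982), §4 (Weil classes), I Ex. 3.7.
  [cite: Deligne1982HodgeCycles, §4]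
* [Shimura1998] G. Shimura, *Abelian Varieties with Complex Multiplication and Modular Functions* (1998), §5.1 Prop. 6
  (`End_ℚ(A) = ι(F)` for `A` simple of CM type), §8.2 Prop. 26. [cite: Shimura1998, §5.1 Prop. 6]
* [MumfordAV1970] D. Mumford, *Abelian Varieties* (1970), §19 (products; Remark p. 169: `End⁰` an isogeny invariant).
  [cite: MumfordAV1970, §19 Remark p. 169]
* [vanGeemen1994HodgeAV] B. van Geemen, LNM 1594 (1994), §2.4, §3.6, Lemma 3.7. [cite: vanGeemen1994HodgeAV, Lemma 3.7]
-/

noncomputable section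

open CategoryTheory CategoryTheory.Limits Module NumberField

namespace Literature.AlgebraicGeometry.HodgeTheory

open Literature.NumberTheory.ComplexMultiplication
open Literature.AlgebraicGeometry.Motives (AbelianVariety CMType)
open Literature.AlgebraicGeometry.Motives.AbelianVariety
open Literature.AlgebraicGeometry.ComplexMultiplication (IsCMTypeRealisation ringHom_endAlgebra_bijective_of_isSimple)
open Literature.AlgebraicGeometry.Pohlmann1968
open Literature.AlgebraicGeometry.Milne1999
open Literature.Barriers.HodgeConjecture

/-! ### §1 Realisation level: `k ↪̸ K` gives the product-span property on all `E^{a+1} × X^{b+1}` -/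

section Realisation

variable {k K : Type} [Field k] [NumberField k] [IsCMField k] [Field K] [NumberField K] [IsCMField K]
  {Φk : CMType k} {ΦK : CMType K} {E' X' E X : AbelianVariety ℂ}
  {ιE : 𝓞 k →+* End E'} {θE : k →+* Module.End ℂ (complexBetti E'.X 1)}
  {ιX : 𝓞 K →+* End X'} {θX : K →+* Module.End ℂ (complexBetti X'.X 1)}

/-- **Moonen–Zarhin Prop. (3.8), CM case, realisation level.**  `E ∼ E'` a realisation of a CM type of the
quadratic field `k`, `X ∼ X'` a realisation of a CM type of the CM field `K`, and NO embedding `k ↪ K`: then for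
all `a, b` every rational Hodge class on `E^{a+1} × X^{b+1}` is a `ℂ`-combination of exterior products of rational
Hodge classes of the two factors (`Hg(E × X) = Hg(E) × Hg(X)` through (3.1)) — rank additivity
(`typeRank_sum_add_one_eq_of_finrank_eq_two_of_isEmpty`) and the slots theorem
(`hodgeClassesProductSpan_of_isIsogenous_biproduct_slots_of_typeRank_add`) along `E^{a+1} ∼ ⨁_{a+1} E'`,
`X^{b+1} ∼ ⨁_{b+1} X'`. [cite: MoonenZarhin1999LowDim, Prop. (3.8) and §3 (3.1)] [cite: vanGeemen1994HodgeAV, §3.6 (p. 236)] -/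
theorem hodgeClassesProductSpan_powSucc_powSucc_of_isCMTypeRealisation_of_isEmpty
    (hE' : IsCMTypeRealisation Φk E' ιE θE) (hX' : IsCMTypeRealisation ΦK X' ιX θX)
    (hk : Module.finrank ℚ k = 2) (he : IsEmpty (k →+* K)) (hEE' : IsIsogenous E E')
    (hXX' : IsIsogenous X X') (a b : ℕ) : HodgeClassesProductSpan (E.powSucc a) (X.powSucc b) :=
  hodgeClassesProductSpan_of_isIsogenous_biproduct_slots_of_typeRank_add
    (K := fun _ : Fin 1 => k) (K' := fun _ : Fin 1 => K) (Φ := fun _ => Φk) (Φ' := fun _ => ΦK)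
    (A := fun _ => E') (A' := fun _ => X') (fun _ => hE') (fun _ => hX')
    (typeRank_sum_add_one_eq_of_finrank_eq_two_of_isEmpty Φk ΦK hk he)
    (fun _ : Fin (a + 1) => (0 : Fin 1)) (fun _ : Fin (b + 1) => (0 : Fin 1))
    ((isIsogenous_powSucc hEE' a).trans (isIsogenous_powSucc_biproduct E' a))
    ((isIsogenous_powSucc hXX' b).trans (isIsogenous_powSucc_biproduct X' b))

end Realisation

/-! ### §2 Intrinsic form: `E` a CM elliptic curve, `X` simple of CM type, no ring map `End⁰(E) → End⁰(X)` -/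

section Intrinsic

variable {E X : AbelianVariety ℂ}

/-- **Moonen–Zarhin Prop. (3.8) for a SIMPLE CM factor, on all powers.**  `E` an elliptic curve of CM type, `X` a
simple abelian variety of CM type of positive dimension, and NO ring homomorphism `End⁰(E) → End⁰(X)` (the centre
of `End⁰(X) = K` is `K` itself; «there exists an embedding of `k` into the center of `End⁰(X)`» negated): then the
Hodge classes of every `E^{a+1} × X^{b+1}` are spanned by exterior products of Hodge classes of the factors.
CM-typed models `E ∼ E'`, `X ∼ X'` (`Milne1999.exists_isCMTyped_isIsogenous_of_isSimple`); an embedding `k ↪ K` of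
their CM fields would produce `End⁰(E) → End⁰(E') = ι(k) ≅ k → K → End⁰(X') → End⁰(X)` (`End⁰` embeds along
isogenies both ways, `IsIsogeny.exists_algHom_injective`; `K → End⁰(X')` extends `𝓞_K → End X'`,
`exists_ringHom_endAlgebra`; `k → End⁰(E')` is bijective for the simple `E'`, `ringHom_endAlgebra_bijective_of_isSimple`),
so `k ↪̸ K` and §1 applies. [cite: MoonenZarhin1999LowDim, Prop. (3.8) and §3 (3.1)] [cite: Shimura1998, §5.1 Prop. 6]
[cite: MumfordAV1970, §19 Remark p. 169] -/
theorem hodgeClassesProductSpan_powSucc_cmCurve_powSucc_of_isSimple_of_isOfCMType_of_isEmpty (hE : E.dim = 1)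
    (hEcm : IsOfCMType E) (hX : X.IsSimple) (hX0 : 0 < X.dim) (hXcm : IsOfCMType X)
    (hfor : IsEmpty (E.endAlgebra →+* X.endAlgebra)) (a b : ℕ) :
    HodgeClassesProductSpan (E.powSucc a) (X.powSucc b) := by
  -- CM-typed models of `E` and `X`
  obtain ⟨E', hE't, hEE'⟩ :=
    exists_isCMTyped_isIsogenous_of_isSimple E (isSimple_of_dim_le_one hE.le) (by omega) hEcm
  obtain ⟨X', hX't, hXX'⟩ := exists_isCMTyped_isIsogenous_of_isSimple X hX hX0 hXcm
  obtain ⟨Φk, _, ιE, θE, hE'⟩ := hE't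
  rename_i k _ _ _
  obtain ⟨ΦK, _, ιX, θX, hX'⟩ := hX't
  rename_i K _ _ _
  have hdE : E'.dim = 1 := by
    obtain ⟨f, hf⟩ := hEE'
    rw [← dim_eq_of_isIsogeny hf, hE]
  have hk : Module.finrank ℚ k = 2 := by rw [finrank_eq_two_mul_dim_of_isCMTypeRealisation hE', hdE]
  -- an embedding `k ↪ K` would give a ring map `End⁰(E) → End⁰(X)`
  have he : IsEmpty (k →+* K) := by
    refine ⟨fun e => ?_⟩
    obtain ⟨iE, -⟩ := exists_ringHom_endAlgebra (A₀ := E') ιE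
    have hbij := ringHom_endAlgebra_bijective_of_isSimple hE'
      ((isSimple_of_dim_le_one hE.le).of_isIsogenous hEE') iE
    obtain ⟨iX, -⟩ := exists_ringHom_endAlgebra (A₀ := X') ιX
    obtain ⟨f, hf⟩ := hEE'
    obtain ⟨g, hg⟩ := hXX'
    obtain ⟨⟨Θ₁, -⟩, -⟩ := hf.exists_algHom_injective
    obtain ⟨-, ⟨Θ₂, -⟩⟩ := hg.exists_algHom_injective
    exact hfor.false (Θ₂.toRingHom.comp (iX.comp (e.comp
      ((RingEquiv.ofBijective iE hbij).symm.toRingHom.comp Θ₁.toRingHom))))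
  exact hodgeClassesProductSpan_powSucc_powSucc_of_isCMTypeRealisation_of_isEmpty hE' hX' hk he hEE' hXX' a b

/-- **If moreover `X` satisfies condition (D), then `E × X` satisfies condition (D)** — `B = D` on all powers
(`EllipticCurve.isStablyNondegenerate` for `E`, the product span of the previous theorem, and Moonen–Zarhin's §3
glue `isStablyNondegenerate_prod_of_forall_productSpan_powSucc`).  For `X` simple of CM type «(D)» is
nondegeneracy of its CM type (Kubota rank `dim X + 1`), automatic for `dim X ≤ 3`.
[cite: MoonenZarhin1999LowDim, Prop. (3.8), §3 (3.1) and Thm. (3.2)] [cite: Gordon1999HodgeAVSurvey, Thm. 7.5 (1) and Def. 7.6] -/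
theorem IsStablyNondegenerate.cmCurve_prod_of_isSimple_of_isOfCMType_of_isEmpty (hXs : IsStablyNondegenerate X)
    (hE : E.dim = 1) (hEcm : IsOfCMType E) (hX : X.IsSimple) (hX0 : 0 < X.dim) (hXcm : IsOfCMType X)
    (hfor : IsEmpty (E.endAlgebra →+* X.endAlgebra)) : IsStablyNondegenerate (E.prod X) :=
  isStablyNondegenerate_prod_of_forall_productSpan_powSucc E X
    (fun N => hodgeClassesProductSpan_powSucc_cmCurve_powSucc_of_isSimple_of_isOfCMType_of_isEmpty hE hEcm hX hX0
      hXcm hfor N N) (EllipticCurve.isStablyNondegenerate hE) hXs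

/-- The same with the factors in the order `X × E`. [cite: MoonenZarhin1999LowDim, Prop. (3.8) and Thm. (3.2)] -/
theorem IsStablyNondegenerate.prod_cmCurve_of_isSimple_of_isOfCMType_of_isEmpty (hXs : IsStablyNondegenerate X)
    (hE : E.dim = 1) (hEcm : IsOfCMType E) (hX : X.IsSimple) (hX0 : 0 < X.dim) (hXcm : IsOfCMType X)
    (hfor : IsEmpty (E.endAlgebra →+* X.endAlgebra)) : IsStablyNondegenerate (X.prod E) :=
  isStablyNondegenerate_prod_of_forall_productSpan_powSucc X E
    (fun N => (hodgeClassesProductSpan_powSucc_cmCurve_powSucc_of_isSimple_of_isOfCMType_of_isEmpty hE hEcm hX hX0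
      hXcm hfor N N).symm) hXs (EllipticCurve.isStablyNondegenerate hE)

/-- All mixed powers `E^{a+1} × X^{b+1}` are then stably nondegenerate. [cite: MoonenZarhin1999LowDim, Prop. (3.8) and Thm. (3.2)]
[cite: Gordon1999HodgeAVSurvey, Def. 7.6 and 7.6.1] -/
theorem IsStablyNondegenerate.powSucc_cmCurve_prod_powSucc_of_isSimple_of_isOfCMType_of_isEmpty
    (hXs : IsStablyNondegenerate X) (hE : E.dim = 1) (hEcm : IsOfCMType E) (hX : X.IsSimple) (hX0 : 0 < X.dim)
    (hXcm : IsOfCMType X) (hfor : IsEmpty (E.endAlgebra →+* X.endAlgebra)) (a b : ℕ) :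
    IsStablyNondegenerate ((E.powSucc a).prod (X.powSucc b)) :=
  (hXs.cmCurve_prod_of_isSimple_of_isOfCMType_of_isEmpty hE hEcm hX hX0 hXcm hfor).powSucc_prod_powSucc a b

end Intrinsic

/-! ### §3 The fourfold row: `E_k × T`, `T` a simple CM threefold with `k ↪̸ End⁰(T)` (Thm. 0.1 (4), not case (a)) -/

section ThreefoldRow

variable {E T : AbelianVariety ℂ}

/-- **MOONEN–ZARHIN Thm. 0.1 (4) for `X ∼ E × T` outside case (a), CM case: an elliptic curve `E` of CM type times a
SIMPLE abelian threefold `T` of CM type admitting NO ring homomorphism `End⁰(E) → End⁰(T)` is stably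
nondegenerate** — `B•(Xⁿ) = D•(Xⁿ)` for all `n`.  (`T` satisfies (D): every simple complex abelian threefold does,
the tree's `AbelianVariety.isStablyNondegenerate_of_isSimple_of_dim_three`; then §2.)  With an embedding
`k ↪ End⁰(T)` one is in case (a), where Weil classes are needed (Thm. 0.1 (1)) — not asserted here.
[cite: MoonenZarhin1999LowDim, Thm. 0.1 (4) and Prop. (3.8)] [cite: Gordon1999HodgeAVSurvey, Thm. 7.5 (1) and Def. 7.6] -/
theorem isStablyNondegenerate_cmCurve_prod_of_isSimple_threefold_of_isOfCMType_of_isEmpty (hE : E.dim = 1)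
    (hEcm : IsOfCMType E) (hT : T.IsSimple) (hT3 : T.dim = 3) (hTcm : IsOfCMType T)
    (hfor : IsEmpty (E.endAlgebra →+* T.endAlgebra)) : IsStablyNondegenerate (E.prod T) :=
  (AbelianVariety.isStablyNondegenerate_of_isSimple_of_dim_three T hT hT3).cmCurve_prod_of_isSimple_of_isOfCMType_of_isEmpty
    hE hEcm hT (by omega) hTcm hfor

/-- The order `T × E`. [cite: MoonenZarhin1999LowDim, Thm. 0.1 (4) and Prop. (3.8)] -/
theorem isStablyNondegenerate_prod_cmCurve_of_isSimple_threefold_of_isOfCMType_of_isEmpty (hE : E.dim = 1)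
    (hEcm : IsOfCMType E) (hT : T.IsSimple) (hT3 : T.dim = 3) (hTcm : IsOfCMType T)
    (hfor : IsEmpty (E.endAlgebra →+* T.endAlgebra)) : IsStablyNondegenerate (T.prod E) :=
  (AbelianVariety.isStablyNondegenerate_of_isSimple_of_dim_three T hT hT3).prod_cmCurve_of_isSimple_of_isOfCMType_of_isEmpty
    hE hEcm hT (by omega) hTcm hfor

/-- `B = D` on every power `(E × T)^{N+1}`. [cite: MoonenZarhin1999LowDim, Thm. 0.1 (4)] -/
theorem isDivisorGenerated_powSucc_cmCurve_prod_of_isSimple_threefold_of_isOfCMType_of_isEmpty (hE : E.dim = 1)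
    (hEcm : IsOfCMType E) (hT : T.IsSimple) (hT3 : T.dim = 3) (hTcm : IsOfCMType T)
    (hfor : IsEmpty (E.endAlgebra →+* T.endAlgebra)) (N : ℕ) : IsDivisorGenerated ((E.prod T).powSucc N) :=
  isStablyNondegenerate_cmCurve_prod_of_isSimple_threefold_of_isOfCMType_of_isEmpty hE hEcm hT hT3 hTcm hfor N

/-- **The Hodge conjecture for every power `(E × T)^{N+1}`** of a CM elliptic curve times a simple CM threefold
outside case (a) — UNCONDITIONALLY (no HC_CM). [cite: MoonenZarhin1999LowDim, Thm. 0.1 (4)] [cite: vanGeemen1994HodgeAV, §2.4 and Lemma 3.7] -/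
theorem hodgeConjectureFor_powSucc_cmCurve_prod_of_isSimple_threefold_of_isOfCMType_of_isEmpty (hE : E.dim = 1)
    (hEcm : IsOfCMType E) (hT : T.IsSimple) (hT3 : T.dim = 3) (hTcm : IsOfCMType T)
    (hfor : IsEmpty (E.endAlgebra →+* T.endAlgebra)) (N : ℕ) :
    HodgeConjectureFor ((E.prod T).powSucc N).dim ((E.prod T).powSucc N).X :=
  (isStablyNondegenerate_cmCurve_prod_of_isSimple_threefold_of_isOfCMType_of_isEmpty hE hEcm hT hT3 hTcm
    hfor).hodgeConjectureFor_powSucc N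

/-- **The Hodge conjecture for the fourfold `E × T` itself** (`N = 0`). [cite: MoonenZarhin1999LowDim, Thm. 0.1 (4)] -/
theorem hodgeConjectureFor_cmCurve_prod_of_isSimple_threefold_of_isOfCMType_of_isEmpty (hE : E.dim = 1)
    (hEcm : IsOfCMType E) (hT : T.IsSimple) (hT3 : T.dim = 3) (hTcm : IsOfCMType T)
    (hfor : IsEmpty (E.endAlgebra →+* T.endAlgebra)) : HodgeConjectureFor (E.prod T).dim (E.prod T).X :=
  (isStablyNondegenerate_cmCurve_prod_of_isSimple_threefold_of_isOfCMType_of_isEmpty hE hEcm hT hT3 hTcm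
    hfor).hodgeConjectureFor

/-- **The Hodge conjecture for everything isogenous to a power of `E × T`** (van Geemen Lemma 3.7).
[cite: MoonenZarhin1999LowDim, Thm. 0.1 (4)] [cite: vanGeemen1994HodgeAV, Lemma 3.7] -/
theorem hodgeConjectureFor_of_isIsogenous_powSucc_cmCurve_prod_of_isSimple_threefold_of_isOfCMType_of_isEmpty
    (hE : E.dim = 1) (hEcm : IsOfCMType E) (hT : T.IsSimple) (hT3 : T.dim = 3) (hTcm : IsOfCMType T)
    (hfor : IsEmpty (E.endAlgebra →+* T.endAlgebra)) {Y : AbelianVariety ℂ} {N : ℕ}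
    (hY : AbelianVariety.IsIsogenous Y ((E.prod T).powSucc N)) : HodgeConjectureFor Y.dim Y.X :=
  (isStablyNondegenerate_cmCurve_prod_of_isSimple_threefold_of_isOfCMType_of_isEmpty hE hEcm hT hT3 hTcm
    hfor).hodgeConjectureFor_of_isIsogenous_powSucc hY

/-- Stable nondegeneracy of everything isogenous to `E × T`. [cite: MoonenZarhin1999LowDim, Thm. 0.1 (4)]
[cite: vanGeemen1994HodgeAV, §3.6 (p. 236)] -/
theorem isStablyNondegenerate_of_isIsogenous_cmCurve_prod_of_isSimple_threefold_of_isOfCMType_of_isEmpty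
    (hE : E.dim = 1) (hEcm : IsOfCMType E) (hT : T.IsSimple) (hT3 : T.dim = 3) (hTcm : IsOfCMType T)
    (hfor : IsEmpty (E.endAlgebra →+* T.endAlgebra)) {Y : AbelianVariety ℂ}
    (hY : AbelianVariety.IsIsogenous Y (E.prod T)) : IsStablyNondegenerate Y :=
  (isStablyNondegenerate_cmCurve_prod_of_isSimple_threefold_of_isOfCMType_of_isEmpty hE hEcm hT hT3 hTcm
    hfor).of_isIsogenous hY

end ThreefoldRow

/-! ### §4 Conversely: a SHARED imaginary quadratic field in odd relative degree kills condition (D) -/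

section SharedField

variable {k K : Type} [Field k] [NumberField k] [IsCMField k] [Field K] [NumberField K] [IsCMField K]
  {Φk : CMType k} {ΦK : CMType K} {E' X' E X : AbelianVariety ℂ}
  {ιE : 𝓞 k →+* End E'} {θE : k →+* Module.End ℂ (complexBetti E'.X 1)}
  {ιX : 𝓞 K →+* End X'} {θX : K →+* Module.End ℂ (complexBetti X'.X 1)}

/-- **Moonen–Zarhin Thm. 0.1 (1) («`D² ≠ B²` in case (a)»), CM form, realisation level.**  `E ∼ E'` realising a CM
type of the quadratic field `k`, `X ∼ X'` realising a CM type of the CM field `K` with `[K:ℚ]/2` ODD, `X'` simple and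
not isogenous to `E'`, and an EMBEDDING `j : k ↪ K`: then `E × X` is NOT stably nondegenerate.  The family
`(Φ_k, Φ_K)` over `Fin 1 ⊕ Fin 1` is separating (simple, non-isogenous members,
`CMAlgebra.isSeparatingFamily_of_isSimple_of_pairwise_not_isIsogenous`) and DEGENERATE (shared quadratic field, odd
relative degrees: `not_isNondegenerateFamily_of_shared_quadratic_of_odd`), so some product of copies `⨁_j A_{π j}`
carries an exceptional Hodge class (`CMAlgebra.exists_exceptional_prod_of_not_isNondegenerateFamily`); but that product
is a retract of `(E' × X')^N` (`IsDivisorGenerated.of_comp_eq_nsmul_id`), which would be divisor-generated.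
[cite: MoonenZarhin1999LowDim, Thm. 0.1 (1) and §3 (3.1)] [cite: Gordon1999HodgeAVSurvey, Thm. 7.5 and 7.6.1]
[cite: Deligne1982HodgeCycles, §4] -/
theorem not_isStablyNondegenerate_prod_of_isCMTypeRealisation_of_ringHom_of_odd
    (hE' : IsCMTypeRealisation Φk E' ιE θE) (hX' : IsCMTypeRealisation ΦK X' ιX θX)
    (hk : Module.finrank ℚ k = 2) (hodd : Odd (Module.finrank ℚ K / 2)) (j : k →+* K) (hXs : X'.IsSimple)
    (hniso : ¬ IsIsogenous E' X') (hEE' : IsIsogenous E E') (hXX' : IsIsogenous X X') :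
    ¬ IsStablyNondegenerate (E.prod X) := by
  classical
  intro hsn
  -- the glued two-slot family over `Fin 1 ⊕ Fin 1`
  letI instF : ∀ i, Field (Sum.elim (fun _ : Fin 1 => k) (fun _ : Fin 1 => K) i) := fun i =>
    Sum.rec (motive := fun i => Field (Sum.elim (fun _ : Fin 1 => k) (fun _ : Fin 1 => K) i))
      (fun _ => inferInstanceAs (Field k)) (fun _ => inferInstanceAs (Field K)) i
  letI instN : ∀ i, NumberField (Sum.elim (fun _ : Fin 1 => k) (fun _ : Fin 1 => K) i) := fun i =>
    Sum.rec (motive := fun i => NumberField (Sum.elim (fun _ : Fin 1 => k) (fun _ : Fin 1 => K) i))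
      (fun _ => inferInstanceAs (NumberField k)) (fun _ => inferInstanceAs (NumberField K)) i
  haveI instC : ∀ i, IsCMField (Sum.elim (fun _ : Fin 1 => k) (fun _ : Fin 1 => K) i) := fun i =>
    Sum.rec (motive := fun i => IsCMField (Sum.elim (fun _ : Fin 1 => k) (fun _ : Fin 1 => K) i))
      (fun _ => inferInstanceAs (IsCMField k)) (fun _ => inferInstanceAs (IsCMField K)) i
  let ΦJ : ∀ i, CMType (Sum.elim (fun _ : Fin 1 => k) (fun _ : Fin 1 => K) i) := fun i =>
    Sum.rec (motive := fun i => CMType (Sum.elim (fun _ : Fin 1 => k) (fun _ : Fin 1 => K) i))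
      (fun _ => Φk) (fun _ => ΦK) i
  let AJ : Fin 1 ⊕ Fin 1 → AbelianVariety ℂ := Sum.elim (fun _ => E') (fun _ => X')
  let ιJ : ∀ i, 𝓞 (Sum.elim (fun _ : Fin 1 => k) (fun _ : Fin 1 => K) i) →+* End (AJ i) := fun i =>
    Sum.rec (motive := fun i => 𝓞 (Sum.elim (fun _ : Fin 1 => k) (fun _ : Fin 1 => K) i) →+* End (AJ i))
      (fun _ => ιE) (fun _ => ιX) i
  let θJ : ∀ i, Sum.elim (fun _ : Fin 1 => k) (fun _ : Fin 1 => K) i →+* Module.End ℂ (complexBetti (AJ i).X 1) :=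
    fun i => Sum.rec
      (motive := fun i => Sum.elim (fun _ : Fin 1 => k) (fun _ : Fin 1 => K) i →+* Module.End ℂ (complexBetti (AJ i).X 1))
      (fun _ => θE) (fun _ => θX) i
  have hAJ : ∀ i, IsCMTypeRealisation (ΦJ i) (AJ i) (ιJ i) (θJ i) := fun i => by
    rcases i with i | i
    · exact hE'
    · exact hX'
  -- separating: simple, pairwise non-isogenous members
  have hdE' : E'.dim = 1 := by
    have := finrank_eq_two_mul_dim_of_isCMTypeRealisation hE'
    omega
  have hsJ : ∀ i, (AJ i).IsSimple := fun i => by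
    rcases i with i | i
    · exact isSimple_of_dim_le_one hdE'.le
    · exact hXs
  have hnisoJ : ∀ i i', i ≠ i' → ¬ IsIsogenous (AJ i) (AJ i') := by
    intro i i' hii'
    rcases i with i | i <;> rcases i' with i' | i'
    · exact absurd (congrArg Sum.inl (Subsingleton.elim i i')) hii'
    · exact hniso
    · exact fun h => hniso h.symm'
    · exact absurd (congrArg Sum.inr (Subsingleton.elim i i')) hii'
  have hsep := CMAlgebra.isSeparatingFamily_of_isSimple_of_pairwise_not_isIsogenous hAJ hsJ hnisoJ
  -- degenerate: the quadratic field `k` is shared (`id : k → k`, `j : k → K`) in odd relative degrees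
  obtain ⟨ι₀⟩ : Nonempty (k →+* ℂ) := inferInstance
  have hodd₀ : Odd (Module.finrank ℚ (Sum.elim (fun _ : Fin 1 => k) (fun _ : Fin 1 => K) (Sum.inl 0)) / 2) := by
    show Odd (Module.finrank ℚ k / 2)
    rw [hk]
    exact odd_one
  have hdeg : ¬ CMAlgebra.IsNondegenerateFamily ΦJ :=
    not_isNondegenerateFamily_of_shared_quadratic_of_odd (K := Sum.elim (fun _ : Fin 1 => k) (fun _ : Fin 1 => K))
      hk ι₀ (i₀ := Sum.inl 0) (i₁ := Sum.inr 0) Sum.inl_ne_inr (RingHom.id k) j hodd₀ hodd ΦJ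
  -- an exceptional Hodge class on some product of copies of `E'`, `X'`
  obtain ⟨N, π, m, c, hcQ, hcH, hcD⟩ := CMAlgebra.exists_exceptional_prod_of_not_isNondegenerateFamily hsep hdeg hAJ
  apply hcD
  -- … which is divisor-generated: a retract of the divisor-generated `(E' × X')^N`
  have hsn' : IsStablyNondegenerate (E'.prod X') := hsn.of_isIsogenous' (hEE'.prod hXX')
  have hD : IsDivisorGenerated (⨁ fun l => AJ (π l)) := by
    let q : ∀ i : Fin 1 ⊕ Fin 1, AJ i ⟶ E' ⊞ X' := fun i =>
      Sum.rec (motive := fun i => AJ i ⟶ E' ⊞ X') (fun _ => biprod.inl) (fun _ => biprod.inr) i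
    let r : ∀ i : Fin 1 ⊕ Fin 1, E' ⊞ X' ⟶ AJ i := fun i =>
      Sum.rec (motive := fun i => E' ⊞ X' ⟶ AJ i) (fun _ => biprod.fst) (fun _ => biprod.snd) i
    have hqr : ∀ i, q i ≫ r i = 𝟙 (AJ i) := fun i => by
      rcases i with i | i
      · exact biprod.inl_fst
      · exact biprod.inr_snd
    rcases Nat.eq_zero_or_pos N with rfl | hN
    · -- the empty product is a retract of `E'`
      refine IsDivisorGenerated.of_comp_eq_nsmul_id (0 : (⨁ fun l : Fin 0 => AJ (π l)) ⟶ E') 0 one_ne_zero ?_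
        ((EllipticCurve.isStablyNondegenerate hdE').isDivisorGenerated)
      exact biproduct.hom_ext _ _ fun l => l.elim0
    · obtain ⟨M, rfl⟩ : ∃ M, N = M + 1 := ⟨N - 1, by omega⟩
      have hP : IsDivisorGenerated (⨁ fun _ : Fin (M + 1) => E' ⊞ X') :=
        ((hsn' M).of_isIsogenous' (isIsogenous_powSucc_biproduct (E'.prod X') M)).of_isIsogenous
          ⟨(biproduct.mapIso fun _ : Fin (M + 1) => biprodIsoProd E' X').hom, isIsogeny_hom_of_iso _⟩
      refine IsDivisorGenerated.of_comp_eq_nsmul_id (biproduct.map fun l => q (π l))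
        (biproduct.map fun l => r (π l)) one_ne_zero ?_ hP
      rw [one_smul]
      exact biproduct.hom_ext _ _ fun l => by simp [hqr]
  exact hD m c hcQ hcH

end SharedField

/-! ### §5 Intrinsic form of the converse: `X` simple of CM type of odd dimension, `End⁰(E) → End⁰(X)` -/

section SharedFieldIntrinsic

variable {E X : AbelianVariety ℂ}

/-- **A ring homomorphism `End⁰(E) → End⁰(X)` kills condition (D) for `E × X`** when `E` is an elliptic curve of CM
type and `X` is a SIMPLE abelian variety of CM type of ODD dimension `≠ 1` (Moonen–Zarhin's case (a) for
`dim X = 3`: «there exists an embedding `k ↪ End⁰(X₂)`» ⟹ «`D²(X) ≠ B²(X)`», Weil classes needed).  CM-typed models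
`E ∼ E'`, `X ∼ X'` (`Milne1999.exists_isCMTyped_isIsogenous_of_isSimple`); the embedding of CM fields `k ↪ K` is
`k → End⁰(E') → End⁰(E) → End⁰(X) → End⁰(X') = ι(K) ≅ K` (`exists_ringHom_endAlgebra`,
`IsIsogeny.exists_algHom_injective`, `ringHom_endAlgebra_bijective_of_isSimple`); then §4.
[cite: MoonenZarhin1999LowDim, Thm. 0.1 (1) and Prop. (3.8)] [cite: Shimura1998, §5.1 Prop. 6] [cite: MumfordAV1970, §19 Remark p. 169] -/
theorem not_isStablyNondegenerate_cmCurve_prod_of_isSimple_of_isOfCMType_of_odd (hE : E.dim = 1)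
    (hEcm : IsOfCMType E) (hX : X.IsSimple) (hXodd : Odd X.dim) (hX1 : X.dim ≠ 1) (hXcm : IsOfCMType X)
    (φ : E.endAlgebra →+* X.endAlgebra) : ¬ IsStablyNondegenerate (E.prod X) := by
  have hX0 : 0 < X.dim := hXodd.pos
  -- CM-typed models of `E` and `X`
  obtain ⟨E', hE't, hEE'⟩ :=
    exists_isCMTyped_isIsogenous_of_isSimple E (isSimple_of_dim_le_one hE.le) (by omega) hEcm
  obtain ⟨X', hX't, hXX'⟩ := exists_isCMTyped_isIsogenous_of_isSimple X hX hX0 hXcm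
  obtain ⟨Φk, _, ιE, θE, hE'⟩ := hE't
  rename_i k _ _ _
  obtain ⟨ΦK, _, ιX, θX, hX'⟩ := hX't
  rename_i K _ _ _
  have hdE : E'.dim = 1 := by
    obtain ⟨f, hf⟩ := hEE'
    rw [← dim_eq_of_isIsogeny hf, hE]
  have hdX : X'.dim = X.dim := by
    obtain ⟨g, hg⟩ := hXX'
    rw [← dim_eq_of_isIsogeny hg]
  have hk : Module.finrank ℚ k = 2 := by rw [finrank_eq_two_mul_dim_of_isCMTypeRealisation hE', hdE]
  have hodd : Odd (Module.finrank ℚ K / 2) := by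
    rw [finrank_eq_two_mul_dim_of_isCMTypeRealisation hX', Nat.mul_div_cancel_left _ two_pos, hdX]
    exact hXodd
  have hX's : X'.IsSimple := hX.of_isIsogenous hXX'
  have hniso : ¬ IsIsogenous E' X' := fun h => by
    obtain ⟨f, hf⟩ := h
    have := dim_eq_of_isIsogeny hf
    omega
  -- the embedding `k ↪ K` of the CM fields
  obtain ⟨iE, -⟩ := exists_ringHom_endAlgebra (A₀ := E') ιE
  obtain ⟨iX, -⟩ := exists_ringHom_endAlgebra (A₀ := X') ιX
  have hbij := ringHom_endAlgebra_bijective_of_isSimple hX' hX's iX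
  have hj : Nonempty (k →+* K) := by
    obtain ⟨f, hf⟩ := hEE'
    obtain ⟨g, hg⟩ := hXX'
    obtain ⟨-, ⟨Θ₁, -⟩⟩ := hf.exists_algHom_injective
    obtain ⟨⟨Θ₂, -⟩, -⟩ := hg.exists_algHom_injective
    exact ⟨(RingEquiv.ofBijective iX hbij).symm.toRingHom.comp
      (Θ₂.toRingHom.comp (φ.comp (Θ₁.toRingHom.comp iE)))⟩
  obtain ⟨j⟩ := hj
  exact not_isStablyNondegenerate_prod_of_isCMTypeRealisation_of_ringHom_of_odd hE' hX' hk hodd j hX's hniso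
    hEE' hXX'

/-- **THE EXACT CRITERION for `E × X`, `E` a CM elliptic curve, `X` simple of CM type of odd dimension `≠ 1`
satisfying (D): `E × X` is stably nondegenerate iff there is NO ring homomorphism `End⁰(E) → End⁰(X)`** (⟸:
§2's `IsStablyNondegenerate.cmCurve_prod_of_isSimple_of_isOfCMType_of_isEmpty`; ⟹: the previous
theorem). [cite: MoonenZarhin1999LowDim, Thm. 0.1 (1)/(4) and Prop. (3.8)] [cite: Gordon1999HodgeAVSurvey, Thm. 7.5] -/
theorem isStablyNondegenerate_cmCurve_prod_iff_isEmpty_of_isSimple_of_isOfCMType_of_odd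
    (hXs : IsStablyNondegenerate X) (hE : E.dim = 1) (hEcm : IsOfCMType E) (hX : X.IsSimple) (hXodd : Odd X.dim)
    (hX1 : X.dim ≠ 1) (hXcm : IsOfCMType X) :
    IsStablyNondegenerate (E.prod X) ↔ IsEmpty (E.endAlgebra →+* X.endAlgebra) :=
  ⟨fun h => ⟨fun φ =>
      not_isStablyNondegenerate_cmCurve_prod_of_isSimple_of_isOfCMType_of_odd hE hEcm hX hXodd hX1 hXcm φ h⟩,
    fun h => hXs.cmCurve_prod_of_isSimple_of_isOfCMType_of_isEmpty hE hEcm hX hXodd.pos hXcm h⟩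

end SharedFieldIntrinsic

/-! ### §6 The dichotomy for `E_k × T`, `T` a simple CM abelian threefold -/

section Threefold

variable {E T : AbelianVariety ℂ}

/-- **Case (a), CM form: an elliptic curve of CM type times a SIMPLE CM abelian threefold ADMITTING a ring
homomorphism `End⁰(E) → End⁰(T)` (an embedding `k ↪ End⁰(T)`) is NOT stably nondegenerate** — «in these cases we
have `D²(X) ≠ B²(X)`»: some power carries exceptional (Weil) classes. [cite: MoonenZarhin1999LowDim, Thm. 0.1 (1) and Introduction (a)]
[cite: Deligne1982HodgeCycles, §4] -/
theorem not_isStablyNondegenerate_cmCurve_prod_of_isSimple_threefold_of_isOfCMType_of_ringHom (hE : E.dim = 1)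
    (hEcm : IsOfCMType E) (hT : T.IsSimple) (hT3 : T.dim = 3) (hTcm : IsOfCMType T)
    (φ : E.endAlgebra →+* T.endAlgebra) : ¬ IsStablyNondegenerate (E.prod T) :=
  not_isStablyNondegenerate_cmCurve_prod_of_isSimple_of_isOfCMType_of_odd hE hEcm hT
    (by rw [hT3]; exact ⟨1, rfl⟩) (by omega) hTcm φ

/-- **MOONEN–ZARHIN'S DICHOTOMY (a)/(4) FOR `E_k × T`, `T` A SIMPLE CM THREEFOLD, as a biconditional**: for `E` an
elliptic curve of CM type and `T` a simple abelian threefold of CM type, `E × T` is stably nondegenerate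
(`B•((E × T)ⁿ) = D•((E × T)ⁿ)` for all `n`) IF AND ONLY IF there is no ring homomorphism `End⁰(E) → End⁰(T)` (no
embedding `k ↪ End⁰(T)` of the CM field of `E`). [cite: MoonenZarhin1999LowDim, Thm. 0.1 (1)/(4), Introduction (a) and Prop. (3.8)]
[cite: Gordon1999HodgeAVSurvey, Thm. 7.5] -/
theorem isStablyNondegenerate_cmCurve_prod_iff_isEmpty_of_isSimple_threefold (hE : E.dim = 1) (hEcm : IsOfCMType E)
    (hT : T.IsSimple) (hT3 : T.dim = 3) (hTcm : IsOfCMType T) :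
    IsStablyNondegenerate (E.prod T) ↔ IsEmpty (E.endAlgebra →+* T.endAlgebra) :=
  isStablyNondegenerate_cmCurve_prod_iff_isEmpty_of_isSimple_of_isOfCMType_of_odd
    (AbelianVariety.isStablyNondegenerate_of_isSimple_of_dim_three T hT hT3) hE hEcm hT (by rw [hT3]; exact ⟨1, rfl⟩)
    (by omega) hTcm

end Threefold

end Literature.AlgebraicGeometry.HodgeTheory

end
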